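import Summits.BirchSwinnertonDyer.BirchSwinnertonDyer.Theorems.GoldfeldAllTwistsTwoConverseTwinGenusDescentMinimal
import Summits.BirchSwinnertonDyer.BirchSwinnertonDyer.Theorems.Rank1ResidualIntModelReduction
import Summits.BirchSwinnertonDyer.Rank1Residual.Supersingular.RationalLadder
import Literature.NumberTheory.EllipticCurves.AnomalousOfRationalTorsionProofs
import HarnessLib

set_option linter.dupNamespace false -- `…BirchSwinnertonDyer.BirchSwinnertonDyer…` is the cell's namespace (D-0017)
set_option autoImplicit false

/-!
# LINE B49 — the FIXED partner curves, V: `E(ℚ)_tors = ℤ/2` EXACTLY on the three minimal models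

Cell `bsd-goldfeld`, seat `bsd-goldfeld-s1p-c301` (prover, gen 6); TARGET v5.2 §2 c301 (f), planner g14
(xvi); support for item `stmt-BirchSwinnertonDyer-19140` (twin″; joint with 20044). HONEST FRAMING:
theorems about three explicit elliptic curves over `ℚ`; nothing about BSD. Not in the Theses cone.

WHY. Theorem A of the genus mechanism (memo `B49-GENUS.md` §3) reads the EXACT leading-term formula of
the fixed partners `784 = [0,−21,0,112,0]`, `3136∓ = [0,∓42,0,448,0]` (file III's bsd.S31 hook gives
`BSDLeadingTermFormula`, whose right-hand side `bsdRHS` carries `(#E(ℚ)_tors)²`): so the kernel needs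
`#E(ℚ)_tors = 2` on the nose, not only «every torsion point has an odd multiple in `{O, T}`».
HOW (§1, generic for a globally minimal two-torsion normal form over `ℚ` with `a² − 4b ∉ ℚ²`): a rational
torsion point is killed by `#Ẽ(𝔽_p)` at every good prime `p ≥ 3` (Silverman VII.3.1(b); tree
`reductionPointCount_nsmul_eq_zero_of_isOfFinAddOrder`); with `#Ẽ(𝔽₃) = 4` and `#Ẽ(𝔽₅) = 6` it is
killed by `2`, hence lies in `E(ℚ)[2] = {O, T}` (seat c3's `eq_zero_or_eq_twoTorsionPoint_of_two_nsmul_eq_zero`);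
so `E(ℚ)_tors = ℤ·T` and `torsionOrder = addOrderOf T = 2`. §2: for the three models `3, 5 ∤ Δ` and the
point counts `4, 6` are KERNEL computations (`reductionPointCount_eq_of_intModel_countPoints`, the
b2b-bsdres `countPoints` recheck by `decide +kernel`). Main statements: `torsion_twoTorsionModel_neg_one`,
`…_neg_two`, `…_two` — each «`IsOfFinAddOrder T ↔ T = O ∨ T = (0,0)`» ∧ «`torsionOrder = 2`».
References: [SilvermanAEC2009] VII.3.1(b), VIII.7; [SilvermanTate2015] §3.5; [CremonaAlgorithms1997] Table 1.
-/

noncomputable section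

open scoped Classical

open WeierstrassCurve Literature.NumberTheory.EllipticCurves
  Literature.NumberTheory.EllipticCurves.Rank1Residual.X11RankOneCertificates
  Summit.BirchSwinnertonDyer.BirchSwinnertonDyer.Rank1Residual.IntModel
  Summit.BirchSwinnertonDyer.Rank1Residual.Supersingular

namespace Summit.BirchSwinnertonDyer.BirchSwinnertonDyer.Theorems.GoldfeldGoodTwists

/-! ## §1 Generic: a good prime with `N₃ = 4` and one with `N₅ = 6` pin the torsion inside `E[2]` -/

/-- `4 • T = 0` and `6 • T = 0` give `2 • T = 0`. [folklore] -/
theorem two_nsmul_eq_zero_of_four_six {A : Type*} [AddCommGroup A] {T : A} (h4 : 4 • T = 0)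
    (h6 : 6 • T = 0) : 2 • T = 0 := by
  have e : (2 : ℕ) • T = 6 • T - 4 • T := by
    rw [show (6 : ℕ) = 2 + 4 by norm_num, add_nsmul, add_sub_cancel_right]
  rw [e, h4, h6, sub_zero]

/-- **Torsion of a two-torsion normal form from two point counts.** Let `W = [0, a, 0, b, 0]` over `ℚ`
be elliptic and globally minimal with `a² − 4b` not a square, `3, 5 ∤ Δ`, `#W̃(𝔽₃) = 4` and
`#W̃(𝔽₅) = 6`. Then the rational torsion points are exactly `O` and `T = (0,0)`: a torsion point is
killed by `#W̃(𝔽_p)` at the good primes `3, 5` (Silverman VII.3.1(b), tree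
`reductionPointCount_nsmul_eq_zero_of_isOfFinAddOrder`), hence by `gcd(4,6) = 2`, and
`W(ℚ)[2] = {O, T}`. (The point group of a curve over `ℚ` carries `ℚ`'s decidable equality here and
the classical one in the generic two-torsion lemmas; `convert` bridges the subsingleton instances.)
[cite: SilvermanAEC2009, VII.3.1(b)] [cite: SilvermanTate2015, §3.5] -/
theorem isOfFinAddOrder_iff_of_counts (W : WeierstrassCurve ℚ) [W.IsElliptic] [W.IsGloballyMinimal]
    [W.IsTwoTorsionNF] (hD : ¬ IsSquare (W.a₂ ^ 2 - 4 * W.a₄))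
    (h3 : ¬ (3 : ℤ) ∣ minimalDiscriminantInt W) (h5 : ¬ (5 : ℤ) ∣ minimalDiscriminantInt W)
    (hN3 : W.reductionPointCount 3 = 4) (hN5 : W.reductionPointCount 5 = 6) (T : W.toAffine.Point) :
    IsOfFinAddOrder T ↔ T = 0 ∨ T = W.twoTorsionPoint := by
  have hTT : W.twoTorsionPoint + W.twoTorsionPoint = 0 := by
    convert W.twoTorsionPoint_add_twoTorsionPoint
  constructor
  · intro hT
    haveI : Fact (Nat.Prime 3) := ⟨by norm_num⟩
    haveI : Fact (Nat.Prime 5) := ⟨by norm_num⟩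
    have k3 := reductionPointCount_nsmul_eq_zero_of_isOfFinAddOrder W 3 (by norm_num) (by exact_mod_cast h3) hT
    have k5 := reductionPointCount_nsmul_eq_zero_of_isOfFinAddOrder W 5 (by norm_num) (by exact_mod_cast h5) hT
    rw [hN3] at k3
    rw [hN5] at k5
    have h2 := two_nsmul_eq_zero_of_four_six k3 k5
    have h := W.eq_zero_or_eq_twoTorsionPoint_of_two_nsmul_eq_zero hD T (by convert h2)
    rcases h with h | h
    · left; convert h
    · right; exact h
  · rintro (rfl | rfl)
    · exact IsOfFinAddOrder.zero
    · exact isOfFinAddOrder_iff_nsmul_eq_zero.mpr ⟨2, two_pos, by rw [two_nsmul, hTT]⟩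

/-- Under the same hypotheses the torsion subgroup is `{O, T} = ℤ·T` and **`#W(ℚ)_tors = 2`**.
[cite: SilvermanAEC2009, VII.3.1(b)] -/
theorem torsionOrder_eq_two_of_counts (W : WeierstrassCurve ℚ) [W.IsElliptic] [W.IsGloballyMinimal]
    [W.IsTwoTorsionNF] (hD : ¬ IsSquare (W.a₂ ^ 2 - 4 * W.a₄))
    (h3 : ¬ (3 : ℤ) ∣ minimalDiscriminantInt W) (h5 : ¬ (5 : ℤ) ∣ minimalDiscriminantInt W)
    (hN3 : W.reductionPointCount 3 = 4) (hN5 : W.reductionPointCount 5 = 6) :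
    W.torsionOrder = 2 := by
  have hTT : W.twoTorsionPoint + W.twoTorsionPoint = 0 := by
    convert W.twoTorsionPoint_add_twoTorsionPoint
  have hT0 : W.twoTorsionPoint ≠ 0 := fun h ↦ twoTorsionPoint_ne_zero W (by convert h)
  have hT2 : addOrderOf W.twoTorsionPoint = 2 := addOrderOf_eq_prime (by rw [two_nsmul, hTT]) hT0
  have htors : AddCommGroup.torsion W.toAffine.Point = AddSubgroup.zmultiples W.twoTorsionPoint := by
    ext P
    rw [AddCommGroup.mem_torsion, isOfFinAddOrder_iff_of_counts W hD h3 h5 hN3 hN5,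
      AddSubgroup.mem_zmultiples_iff]
    constructor
    · rintro (rfl | rfl)
      · exact ⟨0, zero_zsmul _⟩
      · exact ⟨1, one_zsmul _⟩
    · rintro ⟨k, rfl⟩
      rcases Int.even_or_odd k with ⟨m, rfl⟩ | ⟨m, rfl⟩
      · left
        rw [← two_mul, mul_comm, mul_zsmul, two_zsmul, hTT, zsmul_zero]
      · right
        rw [add_zsmul, one_zsmul, mul_comm, mul_zsmul, two_zsmul, hTT, zsmul_zero, zero_add]
  have hcard : Nat.card (AddCommGroup.torsion W.toAffine.Point) = 2 := by
    rw [htors, Nat.card_zmultiples, hT2]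
  unfold WeierstrassCurve.torsionOrder
  convert hcard

/-! ## §2 The three minimal models: `#E(ℚ)_tors = 2` -/

/-- `(0, 0)` lies on `[0, −21, 0, 112, 0]`. [folklore] -/
theorem nonsingular_twoTorsionModel_neg_one_zero :
    (⟨0, -21, 0, 112, 0⟩ : WeierstrassCurve ℚ).toAffine.Nonsingular 0 0 := by
  haveI := isElliptic_twoTorsionModel_neg_one
  exact nonsingular_zero_zero _

/-- **`E(ℚ)_tors = {O, (0,0)}` and `#E(ℚ)_tors = 2` for the `784`-model `[0, −21, 0, 112, 0]`**
(`a² − 4b = −7`; good primes `3, 5 ∤ Δ = −2¹²·7³`, `#Ẽ(𝔽₃) = 4`, `#Ẽ(𝔽₅) = 6` by kernel point counts).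
[cite: SilvermanAEC2009, VII.3.1(b)] [cite: CremonaAlgorithms1997, Table 1 (curve 784)] -/
theorem torsion_twoTorsionModel_neg_one :
    (∀ T : (⟨0, -21, 0, 112, 0⟩ : WeierstrassCurve ℚ).toAffine.Point,
      IsOfFinAddOrder T ↔ T = 0 ∨ T = .some 0 0 nonsingular_twoTorsionModel_neg_one_zero) ∧
    (⟨0, -21, 0, 112, 0⟩ : WeierstrassCurve ℚ).torsionOrder = 2 := by
  haveI := isGloballyMinimal_twoTorsionModel_neg_one
  haveI := isElliptic_twoTorsionModel_neg_one
  haveI : Fact (Nat.Prime 3) := ⟨by norm_num⟩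
  haveI : Fact (Nat.Prime 5) := ⟨by norm_num⟩
  have hI : integralModelInt (⟨0, -21, 0, 112, 0⟩ : WeierstrassCurve ℚ) = ⟨0, -21, 0, 112, 0⟩ :=
    integralModelInt_eq_of_map_eq (⟨0, -21, 0, 112, 0⟩ : WeierstrassCurve ℤ)
      (by ext <;> simp [WeierstrassCurve.map])
  have h3 := not_dvd_minimalDiscriminantInt_of_intModel hI (ℓ := 3) (by decide +kernel)
  have h5 := not_dvd_minimalDiscriminantInt_of_intModel hI (ℓ := 5) (by decide +kernel)
  have hN3 := reductionPointCount_eq_of_intModel_countPoints hI 3 (by norm_num) (by decide +kernel)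
    (n := 4) (by decide +kernel)
  have hN5 := reductionPointCount_eq_of_intModel_countPoints hI 5 (by norm_num) (by decide +kernel)
    (n := 6) (by decide +kernel)
  have hD : ¬ IsSquare ((⟨0, -21, 0, 112, 0⟩ : WeierstrassCurve ℚ).a₂ ^ 2 -
      4 * (⟨0, -21, 0, 112, 0⟩ : WeierstrassCurve ℚ).a₄) := by
    rw [show ((⟨0, -21, 0, 112, 0⟩ : WeierstrassCurve ℚ).a₂ ^ 2 -
      4 * (⟨0, -21, 0, 112, 0⟩ : WeierstrassCurve ℚ).a₄) = -7 by norm_num]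
    exact not_isSquare_rat_neg7_7_2_14.1
  exact ⟨isOfFinAddOrder_iff_of_counts _ hD h3 h5 hN3 hN5, torsionOrder_eq_two_of_counts _ hD h3 h5 hN3 hN5⟩

/-- `(0, 0)` lies on `[0, −42, 0, 448, 0]`. [folklore] -/
theorem nonsingular_twoTorsionModel_neg_two_zero :
    (⟨0, -42, 0, 448, 0⟩ : WeierstrassCurve ℚ).toAffine.Nonsingular 0 0 := by
  haveI := isElliptic_twoTorsionModel_neg_two
  exact nonsingular_zero_zero _

/-- **`#E(ℚ)_tors = 2` for the `3136⁻`-model `[0, −42, 0, 448, 0]`** (`a² − 4b = −28`; `#Ẽ(𝔽₃) = 4`,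
`#Ẽ(𝔽₅) = 6`). [cite: SilvermanAEC2009, VII.3.1(b)] [cite: CremonaAlgorithms1997, Table 1 (curve 3136)] -/
theorem torsion_twoTorsionModel_neg_two :
    (∀ T : (⟨0, -42, 0, 448, 0⟩ : WeierstrassCurve ℚ).toAffine.Point,
      IsOfFinAddOrder T ↔ T = 0 ∨ T = .some 0 0 nonsingular_twoTorsionModel_neg_two_zero) ∧
    (⟨0, -42, 0, 448, 0⟩ : WeierstrassCurve ℚ).torsionOrder = 2 := by
  haveI := isGloballyMinimal_twoTorsionModel_neg_two
  haveI := isElliptic_twoTorsionModel_neg_two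
  haveI : Fact (Nat.Prime 3) := ⟨by norm_num⟩
  haveI : Fact (Nat.Prime 5) := ⟨by norm_num⟩
  have hI : integralModelInt (⟨0, -42, 0, 448, 0⟩ : WeierstrassCurve ℚ) = ⟨0, -42, 0, 448, 0⟩ :=
    integralModelInt_eq_of_map_eq (⟨0, -42, 0, 448, 0⟩ : WeierstrassCurve ℤ)
      (by ext <;> simp [WeierstrassCurve.map])
  have h3 := not_dvd_minimalDiscriminantInt_of_intModel hI (ℓ := 3) (by decide +kernel)
  have h5 := not_dvd_minimalDiscriminantInt_of_intModel hI (ℓ := 5) (by decide +kernel)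
  have hN3 := reductionPointCount_eq_of_intModel_countPoints hI 3 (by norm_num) (by decide +kernel)
    (n := 4) (by decide +kernel)
  have hN5 := reductionPointCount_eq_of_intModel_countPoints hI 5 (by norm_num) (by decide +kernel)
    (n := 6) (by decide +kernel)
  have hD : ¬ IsSquare ((⟨0, -42, 0, 448, 0⟩ : WeierstrassCurve ℚ).a₂ ^ 2 -
      4 * (⟨0, -42, 0, 448, 0⟩ : WeierstrassCurve ℚ).a₄) := by
    rw [show ((⟨0, -42, 0, 448, 0⟩ : WeierstrassCurve ℚ).a₂ ^ 2 -
      4 * (⟨0, -42, 0, 448, 0⟩ : WeierstrassCurve ℚ).a₄) = -28 by norm_num]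
    rintro ⟨r, hr⟩
    exact not_isSquare_rat_neg7_7_2_14.1 (isSquare_of_sq_mul (k := 2) (by norm_num) (by linear_combination hr.symm))
  exact ⟨isOfFinAddOrder_iff_of_counts _ hD h3 h5 hN3 hN5, torsionOrder_eq_two_of_counts _ hD h3 h5 hN3 hN5⟩

/-- `[0, 42, 0, 448, 0]` is elliptic (it is `(1/2, 4, 0, 0) • cm7^{(2)}`). [folklore] -/
theorem isElliptic_twoTorsionModel_two : (⟨0, 42, 0, 448, 0⟩ : WeierstrassCurve ℚ).IsElliptic := by
  haveI := isElliptic_cm7_quadraticTwist_two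
  rw [← twoTorsionChange_smul_cm7_quadraticTwist_two_rat]; infer_instance

/-- `(0, 0)` lies on `[0, 42, 0, 448, 0]`. [folklore] -/
theorem nonsingular_twoTorsionModel_two_zero :
    (⟨0, 42, 0, 448, 0⟩ : WeierstrassCurve ℚ).toAffine.Nonsingular 0 0 := by
  haveI := isElliptic_twoTorsionModel_two
  exact nonsingular_zero_zero _

/-- **`#E(ℚ)_tors = 2` for the `3136⁺`-model `[0, 42, 0, 448, 0]`** (`a² − 4b = −28`; `#Ẽ(𝔽₃) = 4`,
`#Ẽ(𝔽₅) = 6`). [cite: SilvermanAEC2009, VII.3.1(b)] [cite: CremonaAlgorithms1997, Table 1 (curve 3136)] -/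
theorem torsion_twoTorsionModel_two :
    (∀ T : (⟨0, 42, 0, 448, 0⟩ : WeierstrassCurve ℚ).toAffine.Point,
      IsOfFinAddOrder T ↔ T = 0 ∨ T = .some 0 0 nonsingular_twoTorsionModel_two_zero) ∧
    (⟨0, 42, 0, 448, 0⟩ : WeierstrassCurve ℚ).torsionOrder = 2 := by
  haveI := isGloballyMinimal_twoTorsionModel_two
  haveI := isElliptic_twoTorsionModel_two
  haveI : Fact (Nat.Prime 3) := ⟨by norm_num⟩
  haveI : Fact (Nat.Prime 5) := ⟨by norm_num⟩
  have hI : integralModelInt (⟨0, 42, 0, 448, 0⟩ : WeierstrassCurve ℚ) = ⟨0, 42, 0, 448, 0⟩ :=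
    integralModelInt_eq_of_map_eq (⟨0, 42, 0, 448, 0⟩ : WeierstrassCurve ℤ)
      (by ext <;> simp [WeierstrassCurve.map])
  have h3 := not_dvd_minimalDiscriminantInt_of_intModel hI (ℓ := 3) (by decide +kernel)
  have h5 := not_dvd_minimalDiscriminantInt_of_intModel hI (ℓ := 5) (by decide +kernel)
  have hN3 := reductionPointCount_eq_of_intModel_countPoints hI 3 (by norm_num) (by decide +kernel)
    (n := 4) (by decide +kernel)
  have hN5 := reductionPointCount_eq_of_intModel_countPoints hI 5 (by norm_num) (by decide +kernel)
    (n := 6) (by decide +kernel)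
  have hD : ¬ IsSquare ((⟨0, 42, 0, 448, 0⟩ : WeierstrassCurve ℚ).a₂ ^ 2 -
      4 * (⟨0, 42, 0, 448, 0⟩ : WeierstrassCurve ℚ).a₄) := by
    rw [show ((⟨0, 42, 0, 448, 0⟩ : WeierstrassCurve ℚ).a₂ ^ 2 -
      4 * (⟨0, 42, 0, 448, 0⟩ : WeierstrassCurve ℚ).a₄) = -28 by norm_num]
    rintro ⟨r, hr⟩
    exact not_isSquare_rat_neg7_7_2_14.1 (isSquare_of_sq_mul (k := 2) (by norm_num) (by linear_combination hr.symm))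
  exact ⟨isOfFinAddOrder_iff_of_counts _ hD h3 h5 hN3 hN5, torsionOrder_eq_two_of_counts _ hD h3 h5 hN3 hN5⟩

end Summit.BirchSwinnertonDyer.BirchSwinnertonDyer.Theorems.GoldfeldGoodTwists

end
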